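import Mathlib
import HarnessLib

/-!
# Venture HSemireg — reduced-point complexes with two cohomology degrees fail the fibre test
(the linear-algebra core of LEMMA (RP₂))

HONEST FRAMING. Lean leaf for the computation cell `pub-hsemireg` (target seat t-5 gen 12; file of
record `run/shared/lean/pub/pub-hsemireg/target-g6/GRID-BARRIER-t5g9.md` §16.10 (c)(f)(g),
2026-08-23). For a «reduced-point complex» `F` on a smooth threefold germ (all cohomology sheaves are
sums of copies of the reduced point) with cohomology in TWO adjacent degrees, `M⁰ = A`, `M⁻¹ = B`,
the minimal twisted-complex model has gluing blocks `U_{jl} : A → B` (indexed by pairs of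
coordinate directions, symmetric in `j, l`) and the Λ¹-part of any class in the translation-orthogonal
space `W` is a triple `(B_m)` of block-diagonal maps with, for EVERY `j ≠ m`,
`B_m|_A = c · V^{(j)} ∘ U_{mj}` and `B_m|_B = c · U_{mj} ∘ V^{(j)}` for some maps `V^{(i)} : B → A`
subject to the ZERO RELATIONS `U_{jl} ∘ V^{(i)} = 0`, `V^{(i)} ∘ U_{jl} = 0` whenever `i ∉ {j, l}`
(the note's §16.10 (f), derived there from `κ·τ_i ∈ Im D`). THIS FILE kernel-checks the punch line
of §16.10 (g): whenever a third index is available (three coordinate directions), the A-blocks and the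
B-blocks of ANY two such triples multiply to zero in distinct slots — `B_m ∘ B′_{m′} = 0` for
`m ≠ m′` (`blockA_comp_eq_zero`, `blockB_comp_eq_zero`) — so every monomial
`B_{σ1} B′_{σ2} B″_{σ3}` of the top product vanishes (`tripleA_comp_eq_zero`,
`tripleB_comp_eq_zero`) and the volume class is never reached: two-piece reduced-point fibres FAIL
the fibre test for every gluing. The derivation of the block shape from the Hochschild–Koszul model,
the model itself and everything else in §12–§16 of the note are NOT formalised. No object is
constructed; nothing here bears on HC, HC_CM or HC_AV.
-/

namespace Summit.Ventures.HSemireg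

open LinearMap

variable {F : Type*} [Field F]
variable {A B : Type*} [AddCommGroup A] [Module F A] [AddCommGroup B] [Module F B]
variable {ι : Type*}

/-- **A-blocks multiply to zero in distinct slots.** `U : ι → ι → (A →ₗ B)` are the (symmetric)
gluing blocks; a W-class gives `BA : ι → (A →ₗ A)` represented as `BA m = c • V j ∘ U m j` for
every `j ≠ m`; a second W-class gives `BA'` through `V'` with the zero relations
`U j l ∘ V' i = 0` for pairwise distinct `i, j, l`. If every pair of indices has a third index,
then `BA m ∘ BA' m' = 0` for `m ≠ m'` (GRID-BARRIER §16.10 (g)). [folklore] -/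
theorem blockA_comp_eq_zero (U : ι → ι → (A →ₗ[F] B)) (V V' : ι → (B →ₗ[F] A))
    (BA BA' : ι → (A →ₗ[F] A))
    (hrep : ∀ m j, m ≠ j → ∃ c : F, BA m = c • (V j ∘ₗ U m j))
    (hrep' : ∀ m j, m ≠ j → ∃ c : F, BA' m = c • (V' j ∘ₗ U m j))
    (hzero' : ∀ i j l, i ≠ j → i ≠ l → j ≠ l → U j l ∘ₗ V' i = 0)
    (hthird : ∀ m m' : ι, ∃ t, t ≠ m ∧ t ≠ m')
    {m m' : ι} (hmm : m ≠ m') : BA m ∘ₗ BA' m' = 0 := by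
  obtain ⟨t, htm, htm'⟩ := hthird m m'
  obtain ⟨c, hc⟩ := hrep m m' hmm
  obtain ⟨c', hc'⟩ := hrep' m' t (Ne.symm htm')
  have hz : U m m' ∘ₗ V' t = 0 := hzero' t m m' htm htm' hmm
  rw [hc, hc', LinearMap.smul_comp, LinearMap.comp_smul, LinearMap.comp_assoc,
    ← LinearMap.comp_assoc (U m' t) (V' t) (U m m'), hz, LinearMap.zero_comp, LinearMap.comp_zero,
    smul_zero, smul_zero]

/-- **B-blocks multiply to zero in distinct slots** (mirror statement: representation
`BB m = c • U m j ∘ V j`, zero relations `V i ∘ U j l = 0` for the FIRST class). [folklore] -/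
theorem blockB_comp_eq_zero (U : ι → ι → (A →ₗ[F] B)) (V V' : ι → (B →ₗ[F] A))
    (BB BB' : ι → (B →ₗ[F] B))
    (hrep : ∀ m j, m ≠ j → ∃ c : F, BB m = c • (U m j ∘ₗ V j))
    (hrep' : ∀ m j, m ≠ j → ∃ c : F, BB' m = c • (U m j ∘ₗ V' j))
    (hzero : ∀ i j l, i ≠ j → i ≠ l → j ≠ l → V i ∘ₗ U j l = 0)
    (hsymm : ∀ j l, U j l = U l j)
    (hthird : ∀ m m' : ι, ∃ t, t ≠ m ∧ t ≠ m')
    {m m' : ι} (hmm : m ≠ m') : BB m ∘ₗ BB' m' = 0 := by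
  obtain ⟨t, htm, htm'⟩ := hthird m m'
  obtain ⟨c, hc⟩ := hrep m t (Ne.symm htm)
  obtain ⟨c', hc'⟩ := hrep' m' m (Ne.symm hmm)
  have hz : V t ∘ₗ U m' m = 0 := by rw [hsymm]; exact hzero t m m' htm htm' hmm
  rw [hc, hc', LinearMap.smul_comp, LinearMap.comp_smul, LinearMap.comp_assoc,
    ← LinearMap.comp_assoc (V' m) (U m' m) (V t), hz, LinearMap.zero_comp, LinearMap.comp_zero,
    smul_zero, smul_zero]

/-- **Every monomial of the top product vanishes (A-blocks).** For three W-classes and pairwise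
distinct slots `p, q, r`: `BA p ∘ BA' q ∘ BA'' r = 0`; hence the alternating sum
`Σ_σ sgn(σ) B_{σ1} B′_{σ2} B″_{σ3}` — the coefficient of `ξ₁ξ₂ξ₃` in `κκ′κ″` — is zero on `A` and
the volume class (non-zero iff `χ ≠ 0`, leaf `FibreTestTraceAnchor`) is not reached. [folklore] -/
theorem tripleA_comp_eq_zero (U : ι → ι → (A →ₗ[F] B)) (V V' : ι → (B →ₗ[F] A))
    (BA BA' BA'' : ι → (A →ₗ[F] A))
    (hrep : ∀ m j, m ≠ j → ∃ c : F, BA m = c • (V j ∘ₗ U m j))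
    (hrep' : ∀ m j, m ≠ j → ∃ c : F, BA' m = c • (V' j ∘ₗ U m j))
    (hzero' : ∀ i j l, i ≠ j → i ≠ l → j ≠ l → U j l ∘ₗ V' i = 0)
    (hthird : ∀ m m' : ι, ∃ t, t ≠ m ∧ t ≠ m')
    {p q r : ι} (hpq : p ≠ q) : BA p ∘ₗ BA' q ∘ₗ BA'' r = 0 := by
  rw [← LinearMap.comp_assoc, blockA_comp_eq_zero U V V' BA BA' hrep hrep' hzero' hthird hpq,
    LinearMap.zero_comp]

/-- **Every monomial of the top product vanishes (B-blocks).** [folklore] -/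
theorem tripleB_comp_eq_zero (U : ι → ι → (A →ₗ[F] B)) (V V' : ι → (B →ₗ[F] A))
    (BB BB' BB'' : ι → (B →ₗ[F] B))
    (hrep : ∀ m j, m ≠ j → ∃ c : F, BB m = c • (U m j ∘ₗ V j))
    (hrep' : ∀ m j, m ≠ j → ∃ c : F, BB' m = c • (U m j ∘ₗ V' j))
    (hzero : ∀ i j l, i ≠ j → i ≠ l → j ≠ l → V i ∘ₗ U j l = 0)
    (hsymm : ∀ j l, U j l = U l j)
    (hthird : ∀ m m' : ι, ∃ t, t ≠ m ∧ t ≠ m')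
    {p q r : ι} (hpq : p ≠ q) : BB p ∘ₗ BB' q ∘ₗ BB'' r = 0 := by
  rw [← LinearMap.comp_assoc, blockB_comp_eq_zero U V V' BB BB' hrep hrep' hzero hsymm hthird hpq,
    LinearMap.zero_comp]

/-- **Three coordinate directions supply the third index.** On `Fin 3` every pair of indices
has a third one, so the hypotheses `hthird` above are met at `n = 3` (and the lemma is void at
`n = 2`, where the zero relations are empty — the note's remark). [folklore] -/
theorem fin3_exists_third (m m' : Fin 3) : ∃ t : Fin 3, t ≠ m ∧ t ≠ m' := by
  fin_cases m <;> fin_cases m' <;> decide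

/-- **The alternating top coefficient vanishes** (A-blocks, three directions): for three W-classes
with the representation and zero relations of §16.10 (f), the sum over the six orderings
`Σ_σ sgn(σ) B_{σ1} ∘ B′_{σ2} ∘ B″_{σ3}` is `0` — written out for `ι = Fin 3`. [folklore] -/
theorem alternating_tripleA_eq_zero (U : Fin 3 → Fin 3 → (A →ₗ[F] B))
    (V V' : Fin 3 → (B →ₗ[F] A)) (BA BA' BA'' : Fin 3 → (A →ₗ[F] A))
    (hrep : ∀ m j, m ≠ j → ∃ c : F, BA m = c • (V j ∘ₗ U m j))
    (hrep' : ∀ m j, m ≠ j → ∃ c : F, BA' m = c • (V' j ∘ₗ U m j))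
    (hzero' : ∀ i j l, i ≠ j → i ≠ l → j ≠ l → U j l ∘ₗ V' i = 0) :
    (BA 0 ∘ₗ BA' 1 ∘ₗ BA'' 2) - (BA 0 ∘ₗ BA' 2 ∘ₗ BA'' 1) - (BA 1 ∘ₗ BA' 0 ∘ₗ BA'' 2)
      + (BA 1 ∘ₗ BA' 2 ∘ₗ BA'' 0) + (BA 2 ∘ₗ BA' 0 ∘ₗ BA'' 1) - (BA 2 ∘ₗ BA' 1 ∘ₗ BA'' 0) = 0 := by
  have h := fun {p q r : Fin 3} (hpq : p ≠ q) =>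
    tripleA_comp_eq_zero U V V' BA BA' BA'' hrep hrep' hzero' fin3_exists_third (r := r) hpq
  rw [h (by decide), h (by decide), h (by decide), h (by decide), h (by decide), h (by decide)]
  simp

end Summit.Ventures.HSemireg
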